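import Summits.Ventures.WeilGRH.TwistedSechSeries
import Summits.Ventures.WeilGRH.TwistedGramOddReal
import Mathlib.Analysis.SpecialFunctions.Trigonometric.Bounds
import HarnessLib

/-!
# GRH arm (rh-explicit, venture WeilGRH): the `sech` block entries as finite exponential sums with certified tails

Cell `rh-explicit`, WEIL TRACK — GRH ARM (typing seat weil-grh-1).  `TwistedSechSeries.abs_integral_sech_mul_sub_sum_le`
applied to Yoshida's increment kernels, which vanish to first order at `t = 0`:
`|2 − 2(1 − t/2a)cos(ω t)| ≤ (2a ω² + 1/a)·t` and `|sin(ω_m t) − sin(ω_n t)| ≤ |ω_m − ω_n|·t` on `(0, 2a]`.  Hence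
(`abs_sechIncrCoeff_diag_sub_sum_le`, `abs_sechIncrCoeff_offDiag_sub_sum_le`) every entry of `sechIncrCoeff a`
(`TwistedGramOddReal.lean`) is a finite alternating sum of the ELEMENTARY integrals
`∫_{(0,2a]} e^{−(k+½)t}·(kernel) dt`, `k < K`, plus the closed-form diagonal tail `2π − 4 arctan(e^{a})`, up to an
explicit `O(K⁻²)` remainder — the shape a rational / interval certificate of the odd Gram objects needs.  The
elementary integrals are in CLOSED FORM in the tree already (weil-2, `WeilFormatCEntryArchIntegrals.lean`:
`WeilFormatC.integral_exp_neg_mul`, `integral_exp_neg_mul_cos`, `integral_exp_neg_mul_sin`, `integral_mul_exp_neg_mul_cos`,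
with `l = k + ½`, `T = 2a`, `ω = πn/a`, `ωT = 2πn`; the same file expands the EVEN density `ρ₀` over the digamma
nodes, `hasSum_exp_neg_digammaNode_mul`).  No definitions; no named facts; RH/GRH-free.
-/

set_option autoImplicit false

noncomputable section

open Filter Set MeasureTheory
open scoped Real Topology

namespace Summit.Ventures.WeilGRH

variable {a : ℝ}

/-- Yoshida's diagonal increment kernel vanishes to first order: `|2 − 2(1 − t/2a)cos(ωt)| ≤ (2a ω² + 1/a) t` on `(0, 2a]`. -/
theorem abs_diag_kernel_le (ha : 0 < a) (ω : ℝ) {t : ℝ} (ht : t ∈ Ioc 0 (2 * a)) :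
    |2 - 2 * (1 - t / (2 * a)) * Real.cos (ω * t)| ≤ (2 * a * ω ^ 2 + 1 / a) * t := by
  have h0 := ht.1
  have h1 := ht.2
  have hcos := Real.one_sub_sq_div_two_le_cos (x := ω * t)
  have hcos1 := Real.cos_le_one (ω * t)
  have hcosm := Real.neg_one_le_cos (ω * t)
  -- `2 − 2(1 − t/2a)cos = 2(1 − cos) + (t/a) cos`
  have hsplit : 2 - 2 * (1 - t / (2 * a)) * Real.cos (ω * t) =
      2 * (1 - Real.cos (ω * t)) + t / a * Real.cos (ω * t) := by
    field_simp; ring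
  rw [hsplit]
  have hA : |2 * (1 - Real.cos (ω * t))| ≤ 2 * a * ω ^ 2 * t := by
    rw [abs_of_nonneg (by nlinarith)]
    have h2 : 2 * (1 - Real.cos (ω * t)) ≤ (ω * t) ^ 2 := by linarith
    have h3 : (ω * t) ^ 2 = ω ^ 2 * t * t := by ring
    have h4 : ω ^ 2 * t * t ≤ ω ^ 2 * t * (2 * a) := mul_le_mul_of_nonneg_left h1 (by positivity)
    linarith
  have hB : |t / a * Real.cos (ω * t)| ≤ 1 / a * t := by
    rw [abs_mul, abs_of_nonneg (by positivity)]
    calc t / a * |Real.cos (ω * t)| ≤ t / a * 1 :=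
          mul_le_mul_of_nonneg_left (Real.abs_cos_le_one _) (by positivity)
      _ = 1 / a * t := by ring
  calc |2 * (1 - Real.cos (ω * t)) + t / a * Real.cos (ω * t)|
      ≤ |2 * (1 - Real.cos (ω * t))| + |t / a * Real.cos (ω * t)| := abs_add_le _ _
    _ ≤ 2 * a * ω ^ 2 * t + 1 / a * t := add_le_add hA hB
    _ = (2 * a * ω ^ 2 + 1 / a) * t := by ring

/-- The off-diagonal kernel vanishes to first order: `|sin(ω_m t) − sin(ω_n t)| ≤ |ω_m − ω_n| t` for `t ≥ 0`. -/
theorem abs_offDiag_kernel_le (ωm ωn : ℝ) {t : ℝ} (ht : 0 ≤ t) :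
    |Real.sin (ωm * t) - Real.sin (ωn * t)| ≤ |ωm - ωn| * t := by
  have h := Real.abs_sin_sub_sin_le (ωm * t) (ωn * t)
  rwa [← sub_mul, abs_mul, abs_of_nonneg ht] at h

/-- **Diagonal entries of the `sech` block as a finite exponential sum**: for `a > 0`, `n ∈ ℤ`, every `K`,
`|sechIncrCoeff a n n − (2π − 4 arctan e^{a}) − Σ_{k<K} (−1)^k ∫_{(0,2a]} e^{−(k+½)t}(2 − 2(1 − t/2a)cos(πn t/a)) dt|`
`≤ (2a(πn/a)² + 1/a)/(K+½)²`. -/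
theorem abs_sechIncrCoeff_diag_sub_sum_le (ha : 0 < a) (n : ℤ) (K : ℕ) :
    |sechIncrCoeff a n n - (2 * π - 4 * Real.arctan (Real.exp a)) -
        ∑ k ∈ Finset.range K, (-1 : ℝ) ^ k *
          ∫ t in Ioc 0 (2 * a), Real.exp (-((k + 1 / 2) * t)) * (2 - 2 * (1 - t / (2 * a)) * Real.cos (π * n / a * t))| ≤
      (2 * a * (π * n / a) ^ 2 + 1 / a) / (K + 1 / 2) ^ 2 := by
  have hentry : sechIncrCoeff a n n - (2 * π - 4 * Real.arctan (Real.exp a)) =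
      ∫ t in Ioc 0 (2 * a), 1 / (2 * Real.cosh (t / 2)) * (2 - 2 * (1 - t / (2 * a)) * Real.cos (π * n / a * t)) := by
    unfold sechIncrCoeff
    rw [if_pos rfl, integral_sech_density_mul_two_Ioi]
    ring
  rw [hentry]
  exact abs_integral_sech_mul_sub_sum_le (by fun_prop) (by positivity)
    (fun t ht ↦ abs_diag_kernel_le ha _ ht) K

/-- **Off-diagonal entries of the `sech` block as a finite exponential sum**: for `n ≠ m`, every `K`,
with `S_j(k) = ∫_{(0,2a]} e^{−(k+½)t} sin(πj t/a) dt`,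
`|sechIncrCoeff a n m − (−(−1)^{n+m}/(π(n−m)))·Σ_{k<K} (−1)^k (S_m(k) − S_n(k))| ≤ |(−1)^{n+m}/(π(n−m))|·|πm/a − πn/a|/(K+½)²`. -/
theorem abs_sechIncrCoeff_offDiag_sub_sum_le (a : ℝ) {n m : ℤ} (hnm : n ≠ m) (K : ℕ) :
    |sechIncrCoeff a n m -
        (-(-1 : ℝ) ^ (n + m) / (π * (n - m))) * ∑ k ∈ Finset.range K, (-1 : ℝ) ^ k *
          ∫ t in Ioc 0 (2 * a), Real.exp (-((k + 1 / 2) * t)) * (Real.sin (π * m / a * t) - Real.sin (π * n / a * t))| ≤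
      |(-(-1 : ℝ) ^ (n + m) / (π * (n - m)))| * (|π * m / a - π * n / a| / (K + 1 / 2) ^ 2) := by
  have hIs : ∀ j : ℤ, IntegrableOn (fun t ↦ 1 / (2 * Real.cosh (t / 2)) * Real.sin (π * j / a * t)) (Ioc 0 (2 * a)) :=
    fun j ↦ ((continuous_sech_density.mul (by fun_prop)).continuousOn.integrableOn_Icc).mono_set Ioc_subset_Icc_self
  have hentry : sechIncrCoeff a n m = (-(-1 : ℝ) ^ (n + m) / (π * (n - m))) *
      ∫ t in Ioc 0 (2 * a), 1 / (2 * Real.cosh (t / 2)) * (Real.sin (π * m / a * t) - Real.sin (π * n / a * t)) := by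
    unfold sechIncrCoeff
    rw [if_neg hnm, ← integral_sub (hIs m) (hIs n)]
    congr 1
    refine setIntegral_congr_fun measurableSet_Ioc fun t _ ↦ ?_
    ring
  rw [hentry, ← mul_sub, abs_mul]
  refine mul_le_mul_of_nonneg_left ?_ (abs_nonneg _)
  exact abs_integral_sech_mul_sub_sum_le (by fun_prop) (abs_nonneg _)
    (fun t ht ↦ abs_offDiag_kernel_le _ _ ht.1.le) K

end Summit.Ventures.WeilGRH

end
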